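import Summits.BirchSwinnertonDyer.Rank1Residual.Additive.X4ThreeWitnessRefinementRecords1
import Summits.BirchSwinnertonDyer.Rank1Residual.GaloisImage.ThreeCongruenceHesseCertificateLemmas
import Literature.NumberTheory.EllipticCurves.Fisher2012.HesseFamilyThreeReverseProofs
import HarnessLib

/-!
# W44 WITNESS-REFINEMENT RECORDS 1 — θ-FREE TWINS of `bsdp3_visW_v13221g1 / v76797l1 / v84600bq1`
# (cell `b2b-bsdres`, team n1011; road W44 = ST-47e; seat n1011-p03 GEN 12; records = EVIDENCE)

HONEST FRAMING (cell `b2b-bsdres`, run/shared/lean/b2b/bsd-rank1-residual/, verbatim in every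
file): the goal of the cell is to DELETE the COMBINATION-SHAPED residual classes of the
Birch–Swinnerton-Dyer formula for ALL analytic-rank `≤ 1` elliptic curves over `ℚ` — "full BSD
formula for every rank `≤ 1` curve in class `C`" assembled STRICTLY from published theorems — so
that the rank-`≤ 1` remainder becomes exactly the CONSTRUCTION-SHAPED classes, which are TYPED
(missing-input `Prop`s), NOT attempted. This is not "finishing BSD". Team n1011 (N11 = X4 ∧ `p = 3`),
research route on the CONSTRUCTION-SHAPED class X4; RECORDS = CERTIFICATE-EVIDENCE closing NOTHING
beyond their displayed binders; nothing booked; no mark / label / count moved; theorems only.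

## What

FILE 1 of the W44 records (`X4ThreeWitnessRefinementRecords1`, p316782) displays the `3`-congruence
`θ : E′[3] ≃ E[3]` + `hθ` as EVIDENCE binders. n1011-p07's Hesse-pencil sweep
(`HOME/b2b-bsdres-n1011-p07/g10/certs999/certs_all18422.tsv`, kit j142177) carries a certificate
`(l : m), u` for each of the three pairs, so `θ` is DISCHARGED here by ONE call of p07's literal-equation
lemma `VisCerts.torsionIso3_of_hesseCert_mk` (direct, Fisher 2012 Thm. 13.2) /
`…_of_dualHesseCert_mk` (dual, §13; A243 = the tree theorem
`Fisher2012.thm132rev_threeCongruent_dualHessePencil_holds`) BY NAME with p07's numerals (attributed) and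
`norm_num` side goals; each twin `bsdp3_visWHesse_v<label>` = the landed record fed with that `θ`. Displayed
binders left = the named facts, `hr`, `hq`/`hv` (and the pinned partner literal `W′`).

References: [Fisher2012Hessian] Thm. 13.2, §13; [CremonaMazur2000] §3; [Cremona2006] (labels).
-/

set_option autoImplicit false

noncomputable section

open scoped Classical

open WeierstrassCurve Literature.NumberTheory.EllipticCurves Literature.NumberTheory.EllipticCurves.ModularForms
  Literature.NumberTheory.EllipticCurves.Rank1Residual Literature.NumberTheory.EllipticCurves.Rank1Residual.Typed
  Literature.NumberTheory.GaloisRepresentations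
  Summit.BirchSwinnertonDyer.BirchSwinnertonDyer.Rank1Residual.IntModel
  Summit.BirchSwinnertonDyer.Rank1Residual.GaloisImage

namespace Summit.BirchSwinnertonDyer.Rank1Residual.Additive

/-- **θ-free twin of `bsdp3_visW_v13221g1`** (`13221g1 ← 66807k1`; Hesse certificate dual `(l : m) = (-27389202 : 235)`, `u = 1/6`,
n1011-p07 `certs_all18422.tsv`): the congruence `θ : E′[3] ≃ E[3]` IN THE KERNEL, everything else as in the landed record.
Displayed = the named facts, `hr`, `hq`/`hv`. CLOSES NOTHING beyond them; nothing booked.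
[cite: Fisher2012Hessian, §13 (analogue of Thm. 13.2 for X_E^-(3))] [cite: CremonaMazur2000, §3 and Table 1] [cite: Cremona2006, Table 1 (labels 13221g1, 66807k1)] -/
theorem bsdp3_visWHesse_v13221g1
    (hKatoS : Kato2004.rankZero_padicValNat_sha_le_sub_localTamagawa_of_additive_potGood_of_imageContainsSL2)
    (hDel : Delbourgo1998.prop4_rankZero_pow_dvd_constantCoeff)
    (hGZK : rank_eq_analyticRank_of_analyticRank_le_one) (hmod : hasEntireLFunction_rat)
    (hmodD : nonempty_modularParametrizationData)
    (hKatoχ : Wuthrich2014.kato_halfEigenCharIdeal_dvd_cyclotomicPrime_of_surjective)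
    (hCT : exists_casselsTate_pairing (K := ℚ))
    (hU : Silverman1994_thmV53_tateUniformisation.{0})
    (hU2 : Silverman1994_thmV53_corV54_tateUniformisation.{0})
    {W : WeierstrassCurve ℚ} [W.IsElliptic] [W.IsGloballyMinimal]
    (hI : integralModelInt W = ⟨0, 0, 1, -28576947, -59482601771⟩)
    (hr : W.analyticRank = 0) {q : ℚ} (hq : shaAn W = (q : ℂ)) (hv : padicValRat 3 q ≤ 2)
    (W' : WeierstrassCurve ℚ) (hW' : W' = ⟨1, -1, 1, -39236, 4684200⟩) [W'.IsElliptic] :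
    haveI : Fact (Nat.Prime 3) := ⟨Nat.prime_three⟩
    BSDp W 3 := by
  have hE : (⟨0, 0, 1, -28576947, -59482601771⟩ : WeierstrassCurve ℤ).map (Int.castRingHom ℚ) = W := by
    rw [IntModelTam.eq_baseChange_of_integralModelInt hI]; rfl
  -- θ : E′[3] ≃ E[3] IN THE KERNEL — n1011-p07's Hesse certificate (dual: `(l : m) = (-27389202 : 235)`, `u = 1/6`;
  -- `certs_all18422.tsv`, r2 GEN 25 search library) through p07's literal-equation lemma BY NAME (Fisher 2012 Thm. 13.2 / §13 dual, A243 = tree theorem)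
  have hW : W = ⟨0, 0, 1, -28576947, -59482601771⟩ := by rw [← hE]; ext <;> simp [WeierstrassCurve.map]
  obtain ⟨θ, hθ⟩ : X1.CongruenceTransfer.TorsionIso W' W 3 :=
    VisCerts.torsionIso3_of_dualHesseCert_mk Fisher2012.thm132rev_threeCongruent_dualHessePencil_holds hW hW' 1371693456 51392967929928 1883313 (-4038674121)
      (by norm_num) (by norm_num) (by norm_num) (by norm_num) (-27389202) 235 (1 / 6 : ℚ) (by norm_num)
      (by norm_num) (by norm_num)
  exact bsdp3_visW_v13221g1 hKatoS hDel hGZK hmod hmodD hKatoχ hCT hU hU2 hI hr hq hv W' hW' θ hθ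

/-- **θ-free twin of `bsdp3_visW_v76797l1`** (`76797l1 ← 263781a1`; Hesse certificate dual `(l : m) = (-2600229 : 473)`, `u = 1/12`,
n1011-p07 `certs_all18422.tsv`): the congruence `θ : E′[3] ≃ E[3]` IN THE KERNEL, everything else as in the landed record.
Displayed = the named facts, `hr`, `hq`/`hv`. CLOSES NOTHING beyond them; nothing booked.
[cite: Fisher2012Hessian, §13 (analogue of Thm. 13.2 for X_E^-(3))] [cite: CremonaMazur2000, §3 and Table 1] [cite: Cremona2006, Table 1 (labels 76797l1, 263781a1)] -/
theorem bsdp3_visWHesse_v76797l1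
    (hKatoS : Kato2004.rankZero_padicValNat_sha_le_sub_localTamagawa_of_additive_potGood_of_imageContainsSL2)
    (hDel : Delbourgo1998.prop4_rankZero_pow_dvd_constantCoeff)
    (hGZK : rank_eq_analyticRank_of_analyticRank_le_one) (hmod : hasEntireLFunction_rat)
    (hmodD : nonempty_modularParametrizationData)
    (hKatoχ : Wuthrich2014.kato_halfEigenCharIdeal_dvd_cyclotomicPrime_of_surjective)
    (hCT : exists_casselsTate_pairing (K := ℚ))
    (hU2 : Silverman1994_thmV53_corV54_tateUniformisation.{0})
    {W : WeierstrassCurve ℚ} [W.IsElliptic] [W.IsGloballyMinimal]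
    (hI : integralModelInt W = ⟨1, -1, 0, 4343094, -3371182601⟩)
    (hr : W.analyticRank = 0) {q : ℚ} (hq : shaAn W = (q : ℂ)) (hv : padicValRat 3 q ≤ 2)
    (W' : WeierstrassCurve ℚ) (hW' : W' = ⟨0, 0, 1, -11217, -11304734⟩) [W'.IsElliptic] :
    haveI : Fact (Nat.Prime 3) := ⟨Nat.prime_three⟩
    BSDp W 3 := by
  have hE : (⟨1, -1, 0, 4343094, -3371182601⟩ : WeierstrassCurve ℤ).map (Int.castRingHom ℚ) = W := by
    rw [IntModelTam.eq_baseChange_of_integralModelInt hI]; rfl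
  -- θ : E′[3] ≃ E[3] IN THE KERNEL — n1011-p07's Hesse certificate (dual: `(l : m) = (-2600229 : 473)`, `u = 1/12`;
  -- `certs_all18422.tsv`, r2 GEN 25 search library) through p07's literal-equation lemma BY NAME (Fisher 2012 Thm. 13.2 / §13 dual, A243 = tree theorem)
  have hW : W = ⟨1, -1, 0, 4343094, -3371182601⟩ := by rw [← hE]; ext <;> simp [WeierstrassCurve.map]
  obtain ⟨θ, hθ⟩ : X1.CongruenceTransfer.TorsionIso W' W 3 :=
    VisCerts.torsionIso3_of_dualHesseCert_mk Fisher2012.thm132rev_threeCongruent_dualHessePencil_holds hW hW' (-208468503) 2911763658987 538416 9767289960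
      (by norm_num) (by norm_num) (by norm_num) (by norm_num) (-2600229) 473 (1 / 12 : ℚ) (by norm_num)
      (by norm_num) (by norm_num)
  exact bsdp3_visW_v76797l1 hKatoS hDel hGZK hmod hmodD hKatoχ hCT hU2 hI hr hq hv W' hW' θ hθ

/-- **θ-free twin of `bsdp3_visW_v84600bq1`** (`84600bq1 ← 52200cd1`; Hesse certificate direct `(l : m) = (-1385940 : 31)`, `u = 24669360`,
n1011-p07 `certs_all18422.tsv`): the congruence `θ : E′[3] ≃ E[3]` IN THE KERNEL, everything else as in the landed record.
Displayed = the named facts, `hr`, `hq`/`hv`. CLOSES NOTHING beyond them; nothing booked.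
[cite: Fisher2012Hessian, Thm. 13.2 (n = 3)] [cite: CremonaMazur2000, §3 and Table 1] [cite: Cremona2006, Table 1 (labels 84600bq1, 52200cd1)] -/
theorem bsdp3_visWHesse_v84600bq1
    (hKatoS : Kato2004.rankZero_padicValNat_sha_le_sub_localTamagawa_of_additive_potGood_of_imageContainsSL2)
    (hDel : Delbourgo1998.prop4_rankZero_pow_dvd_constantCoeff)
    (hGZK : rank_eq_analyticRank_of_analyticRank_le_one) (hmod : hasEntireLFunction_rat)
    (hmodD : nonempty_modularParametrizationData)
    (hKatoχ : Wuthrich2014.kato_halfEigenCharIdeal_dvd_cyclotomicPrime_of_surjective)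
    (hCT : exists_casselsTate_pairing (K := ℚ))
    (hU2 : Silverman1994_thmV53_corV54_tateUniformisation.{0})
    {W : WeierstrassCurve ℚ} [W.IsElliptic] [W.IsGloballyMinimal]
    (hI : integralModelInt W = ⟨0, 0, 0, -98501475, -479119387250⟩)
    (hr : W.analyticRank = 0) {q : ℚ} (hq : shaAn W = (q : ℂ)) (hv : padicValRat 3 q ≤ 2)
    (W' : WeierstrassCurve ℚ) (hW' : W' = ⟨0, 0, 0, -8175, 334375⟩) [W'.IsElliptic] :
    haveI : Fact (Nat.Prime 3) := ⟨Nat.prime_three⟩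
    BSDp W 3 := by
  have hE : (⟨0, 0, 0, -98501475, -479119387250⟩ : WeierstrassCurve ℤ).map (Int.castRingHom ℚ) = W := by
    rw [IntModelTam.eq_baseChange_of_integralModelInt hI]; rfl
  -- θ : E′[3] ≃ E[3] IN THE KERNEL — n1011-p07's Hesse certificate (direct: `(l : m) = (-1385940 : 31)`, `u = 24669360`;
  -- `certs_all18422.tsv`, r2 GEN 25 search library) through p07's literal-equation lemma BY NAME (Fisher 2012 Thm. 13.2)
  have hW : W = ⟨0, 0, 0, -98501475, -479119387250⟩ := by rw [← hE]; ext <;> simp [WeierstrassCurve.map]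
  obtain ⟨θ, hθ⟩ : X1.CongruenceTransfer.TorsionIso W' W 3 :=
    VisCerts.torsionIso3_of_hesseCert_mk hW hW' 4728070800 413959150584000 392400 (-288900000)
      (by norm_num) (by norm_num) (by norm_num) (by norm_num) (-1385940) 31 24669360 (by norm_num)
      (by norm_num) (by norm_num)
  exact bsdp3_visW_v84600bq1 hKatoS hDel hGZK hmod hmodD hKatoχ hCT hU2 hI hr hq hv W' hW' θ hθ

end Summit.BirchSwinnertonDyer.Rank1Residual.Additive

end
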